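import Summits.BirchSwinnertonDyer.BirchSwinnertonDyer.Theses.QuadraticBranchSignedControl
import Summits.BirchSwinnertonDyer.Rank1Residual.Additive.FouquetWanLocus
import Summits.BirchSwinnertonDyer.Rank1Residual.Additive.QuadraticBranchKatoBridge
import Summits.BirchSwinnertonDyer.BirchSwinnertonDyer.Theorems.QuadraticBranchSignedControlPlusEtaLowerInclusionRankZeroPairs
import Summits.BirchSwinnertonDyer.BirchSwinnertonDyer.Theorems.QuadraticBranchSignedControlPlusEtaLowerInclusionRung39675m1ByName
import Summits.BirchSwinnertonDyer.BirchSwinnertonDyer.Theorems.QuadraticBranchSignedControlPlusEtaLowerInclusionR0OfLowerBSDByName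
import Summits.BirchSwinnertonDyer.BirchSwinnertonDyer.Theorems.QuadraticBranchSignedControlPlusEtaLowerInclusionKuriharaCut
import Summits.BirchSwinnertonDyer.BirchSwinnertonDyer.Theorems.QuadraticBranchSignedControlPlusEtaLowerInclusionCastellaSanoRoad
import HarnessLib

/-!
**v6b CANDIDATE — the 7-STUB VARIANT of v6 (the three held input stubs bundled into ONE, `stub_input_etaNamedFacts`; everything else = v6) (seat k8eta-c1 g14, 2026-08-28, on planner bsd-potss-plan g28's ruling R269 / INBOX 12:24:25Z: «no route edit
possible (19601 is depth 1 under 19242) ⇒ vehicle = SKELETON v6 by the k8eta-c1 lead»; for the tenure planner's adoption —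
`ledger crux write` on this crux is operator/planner-only for the k8eta-c1 units (refused 13:1xZ), so the seat files the candidate
as evidence + HOME mirror `k8eta-c1/g14/` exactly as g8 did for v5; v5 = sha `d5f6e6e5ddc2`, to be archived verbatim as
`Lines/v5_d5f6e6e5ddc2.lean`; local replica of the `#h21_check_skeleton` audit: ok = true, codes [], theorem =
`plusEtaLowerInclusion_of_stubs`, 9 sorried stubs).** v6 = v5 with the Kurihara cut RE-TYPED IN INPUT CURRENCY and its named inputs DISPLAYED AS
STUBS BY NAME (the R139 pattern at crux level), composed over seat g13's LANDED (B) theorem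
`PlusEtaCastellaSanoRoad.plusEtaLowerInclusion_of_kim111_of_cs26_of_maninFacts_of_kuriharaUnit_of_kimDefect` (p632747):
* `stub_etaLower_kuriharaUnit_tamFreeRows` (CONTENT, replaces v5's `stub_etaLower_kurihara_tamFree`): for every ADMISSIBLE
  parametrisation datum `D` (`p ∤ c_D`, `p`-unit period transfer) of every Tamagawa-`p`-free globally minimal partner `W` of a
  tower-onto Gss2 twist, `X4.KuriharaUnitAt W p D.f` — Kurihara's conjecture mod `p` (Kim Conj. 1.9 = Castella–Sano Conj. 1) =
  `hKur` of p632747 VERBATIM; the Manin half of v5's Σ₁ datum is a theorem since g9 (`PlusEtaManinInput.maninInput_of_quadraticBranch`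
  modulo `stub_input_maninFacts`), so v5's statement follows (`kurihara_tamFree_of_maninFacts_of_kuriharaUnit`, below, no sorry);
  EVIDENCE: unit Kurihara number on 3098/3098 Tamagawa-free partners at `p ∈ {5,7}` (g7/g8 censuses), 20/20 Tamagawa-free census rows
  with a kernel record;
* `stub_etaLower_kimDefect_tamRows` (CONTENT, hardest; replaces v5's `stub_etaLower_tamagawaRows`): for every admissible datum `D` of
  every tower-onto partner `W` with `p ∣ ∏ c_ℓ(W)`, Kim's Tamagawa-defect identity `X4.KimTamagawaDefectAt W p D.f`
  (`∂^{(∞)}(δ̃(D.f)) = ord_p ∏_v c_v(W)`) — Kim Conj. 1.10 = Castella–Sano Conj. 2 on the Tamagawa partners = `hDef` of p632747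
  VERBATIM; OPEN per row; its `≤` half is a finite certificate (CERTIFIED on 20/20 Tamagawa census rows: g13 kit j308348 15/15 r1 rows by
  one cyclic level-(t+1) Kolyvagin prime with `v_p(δ_ℓ) = t`, r0 rows g5/g6), its `≥` half is the Kato-integrality side (0 violations
  in 275 levels; not certifiable); v5's (E⁺_η)-currency statement follows modulo `stub_input_cs26Eta` + `stub_input_maninFacts`
  (`tamagawaRows_of_cs26_of_maninFacts_of_kimDefect`, below = g13 §3);
* HELD INPUT STUBS BY NAME (cite-level; NOT prover targets — closable only by a Literature `_holds` theorem or a DOI re-typing):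
  `stub_input_kim111Eta` : `Kim2026.thm111_etaEisensteinInclusion_of_kuriharaNumber_ne_zero` (PUBLISHED, Amer. J. Math. 148, read at
  `η`; p534181); `stub_input_cs26Eta` : `CastellaSano2026.thm1_etaEisensteinInclusion_of_kimTamagawaDefect_OPEN` (PREPRINT
  arXiv:2601.14504 Thm. 1, January 2026, UNREFEREED — NOT a fact; OPEN binder p631508; W2 watch = its DOI / Kurihara–Sakamoto);
  `stub_input_maninFacts` : Mazur 1978 Cor. 4.1 ∧ Abbes–Ullmo 1996 Thm. A ∧ Česnavičius 2018 Thm. 1.2 ∧ modularity (PUBLISHED);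
* `PlusEtaLowerInclusion_of (hKim) (hCS) (hMF) (hKur) (hDef)` := p632747 (B) (argument bundling only) and
  `plusEtaLowerInclusion_of_stubs` — the crux BY NAME, sorries ONLY in the five stubs it consumes; PRIMARY for the audit.
v4's locus cut is KEPT as the secondary composition (`PlusEtaLowerInclusion_of_locusCut` / `plusEtaLowerInclusion_of_locusStubs`;
stubs `_fwLocus` (k8-fw's road: ⟸ ONE PRE binder `FouquetWan2021.thm51_etaKatoMC_OPEN`, p464644) / `_offLocus` unchanged), and so
are the BC5 rung stub and the r0 L₀ stub with their compositions. REGISTERED STUBS after v6 = 9: six CONTENT (`_fwLocus`, `_offLocus`,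
`_rung_39675m1`, `_r0_lowerBSD`, `_kuriharaUnit_tamFreeRows`, `_kimDefect_tamRows`) + three HELD INPUTS (`stub_input_*`); the
wave cap stubs_max = 7 counts prover targets — the three input stubs are typist/literature duties (if the tenure planner wants ≤ 7
names: expire `_offLocus` — no road, implied by the primary cut — and merge `stub_input_kim111Eta ∧ stub_input_maninFacts`).
EFFECT: modulo the three displayed inputs (one PRE) the open content of 19601 is TWO NAMED PER-ROW CONJECTURE STATEMENTS on the
additive partners — Kurihara unit (Tamagawa-free rows) / Kim defect (Tamagawa rows). Farm: rc 0, NINE `sorry`s = nine stubs,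
0 errors. HONEST FRAMING: conditional throughout; the crux, (E⁺) and BSD are exactly as open as before; nothing booked.
-/

/-!
**v5 (planner bsd-potss-plan g26, 2026-08-28 — ADOPTED WITH ONE RESHAPE from seat k8eta-c1 g8's candidate, evidence #47/#48 on
stmt-BirchSwinnertonDyer-19601, mirror HOME/k8eta-c1/g8/PlusEtaLowerInclusion_birth_v5_candidate.lean sha16 003c706321cf9942).**
v5 = the REGISTERED v4 (sha `f52b9fac6fa9`; byte-identical below the v4 docstring except ONE added import) + a SECOND,
EVIDENCE-ALIGNED composition of the crux — THE KURIHARA CUT — over the seat's LANDED closer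
`PlusEtaKuriharaCut.plusEtaLowerInclusion_of_kim111_of_kuriharaData_of_tamagawaRows` (p599308). TWO content stubs added
(4 + 2 = 6 ≤ stubs_max 7), none removed, v4's `_of` (Fouquet–Wan locus cut) untouched and still primary for the audit:
* `stub_etaLower_kurihara_tamFree` (Σ₁ CONTENT stub): every Tamagawa-`p`-free globally minimal partner `W` of a tower-onto Gss2
  twist `V` (`p ≥ 5`) carries an admissible parametrisation datum (`p ∤ c_D`, `p`-unit period transfer — Manin's `c = ±1` for the
  optimal curve; Cremona for `N < 500000`) AND a unit Kurihara number at a cyclic `𝒩₁`-level — Manin's input + Kurihara's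
  conjecture mod `p` (Kim Conj. 1.9), verbatim the data binders of `PlusEtaKuriharaT0.etaPair_of_thm111_of_kuriharaUnit`;
  EVIDENCE (seat k8eta-c1 g5–g8, kit j260432/j261654/j282474/j283099/j283103): a unit Kurihara number on 2044/2044 (`p = 5`) +
  1040/1040 (`p = 7`) Tamagawa-free rank-one partners and 14/14 Tamagawa-free rank-zero census rows; the 20 Tamagawa-free
  tower-onto census rows (r0 14, r1 6) all carry a kernel record (`…PlusEtaKuriharaRecordsLocalTorsion01/02`, `…Rows07`);
  why_might_fail: a Tamagawa-free partner all of whose Kurihara numbers vanish mod `p` (none in 3098 computed rows), or `p ∣ c`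
  for an optimal curve at a prime of additive reduction (open beyond Cremona's range);
* `stub_etaLower_tamagawaRows` (CONTENT stub, the hardest of the cut): (E⁺_η) on the tower-onto pairs with `p ∣ ∏ c_ℓ(W)` —
  Kato's lower inclusion for `f_W` where Kim's criterion is void (Remark 6.2: 0/234 units); per row = Λ-primitivity of
  `κ^{Kato,∞}(W)` (Kim Thm. 1.4), no finite certificate known; 20 census rows (r1 15, r0 5), 19 certified only by LEVEL-ZERO
  instruments (Tamagawa road, Mordell–Weil road, level-2 Kurihara number, unit `Ш_an`), residue `69150v1`;
* `PlusEtaLowerInclusion_of_kuriharaCut (hKim) (hKur) (hTam)` / `plusEtaLowerInclusion_of_kim111_of_kuriharaStubs (hKim)`: the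
  crux BY NAME from the two stubs MODULO the named fact Kim 2026 Thm. 1.11 (1) ⟹ (3) at `η`
  (`Kim2026.thm111_etaEisensteinInclusion_of_kuriharaNumber_ne_zero`, p534181, flag `Kim26-111-eta-zeta-line`) in HYPOTHESIS
  position — one line over p599308.
THE RESHAPE (planner): the candidate's third stub `stub_etaLower_kim111 : Kim2026.thm111_… := by sorry` (a CITE-LEVEL input, «not
a prover target» in the seat's own words) is NOT registered: by the v4 rule of record (R136: registered stubs = the OPEN
mathematics only; published inputs enter as hypotheses of the compositions, exactly as Poitou–Tate / Kobayashi 2.2_η, 4.1_η /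
Kitajima–Otsuki 1.3 / modularity / GZK enter `etaLower_r0_of_stubs`) the named fact is a binder of the Kurihara-cut composition,
which keeps one stub slot free and no sorried cite in the registry. CURRENCY: the Tamagawa currency `p ∣ ∏ c_ℓ(W)` of p599308 is
kept (the records are keyed by it); the split-multiplicative currency is equivalent for `p ≥ 5` by p601509
`PlusEtaKuriharaCut.tamagawaFree_iff_forall_split` with the matching closer `…_of_splitRows` — a prover who prefers it files the
one-line transport, no re-registration needed. BY-NAME RULE (R136): the two new stubs are registered in `Sig.` form like v4's
four; a by-name closer of either needs a spelled-out re-registration first (ask the tenure planner on INBOX) — none is expected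
soon (both are class-wide open statements; per-row instances land as `--supports 19601` helpers). Farm: rc 0, SIX `sorry`s =
six stubs, 0 errors. HONEST FRAMING: conditional throughout; the crux, (E⁺) and BSD are exactly as open as before; nothing booked.
-/


/-!
# BC3 birth skeleton v4 — child crux `PlusEtaLowerInclusion` (item stmt-BirchSwinnertonDyer-19601, route K8
`QuadraticBranchSignedControl` rev 20; the OPEN CORE of the deciding crux (E⁺) `PlusLowerInclusionSurjBranch`
(19242) after the R102a glued split of rev 18: the Eisenstein ("lower") inclusion of Kobayashi's even main
conjecture AT `η = ω^{(p−1)/2}` — `Char(X⁺(V/K_∞)^η) ⊆ (L_p⁺(V, η, X))` VERBATIM on the `η`-component object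
(`QuadraticBranchPlusEtaLowerInclusionAt V p`, seat k8q-c2 g2) — on the `p`-adic-tower-onto Gss2 twists `V`
(good supersingular `a_p(V) = 0`, `p ≥ 5`); the descent frame 19602 and the held Kobayashi inputs 19603/19604
are the glue's other legs (19605 CLOSED); planner bsd-potss-plan g14, 2026-08-26)

= the parent's registered skeleton (`HOME/plan/percrux4/K8_PlusLowerInclusionSurjBranch_birth.lean`) moved
from the `ℚ(√p*)`-subtower currency to the print currency of the child, cut by the SAME locus:

* `stub_etaLower_fwLocus` — tower-onto twists INSIDE the Fouquet–Wan sub-locus of Gss2 (the additive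
  partner `W = V ⊗ χ_{p*}` has a non-split multiplicative prime with `W[p]` ramified and
  `SL₂(ℤ_p) ⊆ im ρ_{W,p^∞}`): the CLAIMED two-layer parent (Fouquet–Wan arXiv:2107.13726 Thm 5.1, PRE ⟹
  KMC(f_W) ⟹ the `η`-component by Kato Thm 12.5 / Kobayashi's proof of Thm 7.4 at `η`); open as a closed
  statement;
* `stub_etaLower_offLocus` — tower-onto twists OUTSIDE the sub-locus (e.g. prime-power conductor partners):
  the Eisenstein inclusion of the even signed main conjecture at `η ≠ 1` — nothing in print (the proved
  ±/Kato main conjectures sit on the trivial component of `Δ`);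
* `stub_etaLower_rung_39675m1` — BC5 PLAN-ONLY rung (J g4 add-1: «E⁺_η at ONE explicit Gss2 pair»): `V` =
  the good twist by `5* = 5` of `W₀ = 39675m1 = [0,−1,1,−506958,−159508807]` (Gss2 at `5`, `ρ̄` onto,
  `r_an = 0`, `ord₅ #Ш_an(W₀) = 2`, `ord₅ Tam = 0`; additive-p4 GEN 22 kit j135839: a UNIT Kurihara number at
  the cyclic pair level `n = 6541 = 31·211` ⟹ BSD₅(W₀) via Kim 2026 Thm 1.8 (6)); technique: BSD₅(W₀) exact
  ⟹ `ord₅ g_η(0) = ord₅ L_η(0)` through the `η`-transport + signed control (items 19583/19602) ⟹ with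
  Thm 4.1 (`n = 0`, tower onto) equality of ideals ⟹ (E⁺_η)(V); outside S's known regime for the additive
  `W₀` (no `p`-adic `L`-function at an additive prime) and OFF `L_{II*,5}` (Gss2 = `e = 2`, not II*). Not
  consumed by `_of`.

v2 (planner bsd-potss-plan g16, 2026-08-26, after k8-rung g0's p459681
`Theorems.quadraticBranchPlusEtaLowerInclusionAt_of_namedFacts_of_selmerWitness` / `_of_shaWitness` LANDED —
the CONVERSE road: on a tower-onto pair with `L(W,1) ≠ 0`, (E⁺_η)(V) FOLLOWS from the named facts Kobayashi
Thm 2.2_η / 4.1_η, Kitajima–Otsuki 1.3, modularity and the LOWER `p`-part of BSD for the additive partner `W`).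
Three stubs ADDED, none removed, `_of` unchanged (the locus cut stays primary; k8-fw's typed road targets
`stub_etaLower_fwLocus` verbatim):
* `stub_etaLower_rung_39675m1_inputs` — the BC5 rung in INPUTS form, SPELLED OUT (v3 = the header of k8-rung g0's
  by-name file `HOME/k8-rung/…Rung39675m1ByName.lean`, 20:03Z, VERBATIM: `W₀` as the literal, no `Sig` abbreviation, the
  three unused instance binders of v2 dropped): named facts Kobayashi 2.2_η / 4.1_η, Kitajima–Otsuki 1.3, modularity + the
  DISPLAYED row data of `W₀ = 39675m1` at `5` (`L(W₀,1) ≠ 0`; the Selmer-shape lower witness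
  `v₅(L(W₀,1)/Ω) ≤ ord₅ #Sel_{5^∞}(W₀)` = per row the output of Kim 2026 Thm 1.8 (6) on the unit Kurihara number of
  `X4.KimAdditiveRecordsExt.cert_X4ext_39675m1_p5`) ⟹ (E⁺_η) at `5` for every good twist of `W₀` — closes BY NAME from
  p461640 `Theorems.stub_etaLower_rung_39675m1_of_namedFacts_of_selmerWitness` (Kim-INPUT twin `…_of_kim` there too;
  `isGloballyMinimal_39675m1` / `isElliptic_39675m1` PROVED there). Closing it = the rung «closed modulo displayed
  per-row inputs»;
* `stub_etaLower_r0_lowerBSD` — the r_an(W) = 0 SUB-CUT of BOTH locus stubs, typed as what is really open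
  class-wide on it: L₀ = `MissingLowerBoundAt W p` (ord_p #Ш_an ≤ ord_p #Ш) on the Gss2 partners `W` of the
  tower-onto twists with `L(W,1) ≠ 0` — the K8 sibling of the L₀ cores 19618 (KT) / 19663 (K9); per pair = one
  unit Kurihara number (Kim), class-wide = Kato's lower inclusion for `f_W`; harvestable per pair by the kur seats;
* `stub_etaLower_r0_ofLowerBSD` — CONVERSE CONTROL modulo the named facts (v3: + Poitou–Tate duality `hPT`, needed on the
  `p ∣ Tam(W)` rows — k8-rung 19:48Z; = ctrl g4's landed `quadraticBranchPlusEtaLowerInclusionAt_of_missingLowerBoundAt_of_surjective`), in the cell's L₀ currency: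
  facts ⟹ (L₀(W) ⟹ (E⁺_η)(V)) on the r0 tower-onto pairs. On rows with `p ∤ Tam(W)` it is p459681
  `_of_shaWitness` + bookkeeping; on rows with `p ∣ Tam(W)` it needs the Tamagawa-carrying control (B.D. Kim's
  formula; ctrl g4 draft2 §3 `…_of_missingLowerBoundAt_of_surjective`) — ctrl's by-name target.
So on r0 rows 19601 ⟸ facts + L₀(W) (stubs r0_ofLowerBSD + r0_lowerBSD); rows with `L(W,1) = 0` stay on the
locus stubs only (the constant-term squeeze says nothing there).

v4 (planner bsd-potss-plan g17, 2026-08-26): the two DELIVERED legs leave the sorried stub set and are IMPORTED as the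
landed theorems they now are — `stub_etaLower_r0_ofLowerBSD` CLOSED BY NAME (p468146, seat ctrl g4,
`Theorems.PlusEtaLowerInclusionR0OfLowerBSD.stub_etaLower_r0_ofLowerBSD`, after ctrl's spelled-out re-registration) and
`stub_etaLower_rung_39675m1_inputs` DELIVERED IN SUBSTANCE by p465828 (seat k8-rung g0,
`Theorems.PlusEtaLowerInclusionRung39675m1.stub_etaLower_rung_39675m1_inputs`, accepted as a helper before the v3
registration; the verbatim alias p467151 bounced `dedup.landed`, so no by-name credit is attachable — the skeleton now USES
the theorem instead: `rung_39675m1_of_facts_of_inputs`). Registered stubs after v4 = the OPEN mathematics only: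
`stub_etaLower_fwLocus` · `stub_etaLower_offLocus` (primary cut, `_of`) · `stub_etaLower_rung_39675m1` (BC5 rung, now =
«4 named facts + `L(W₀,1) ≠ 0` + the Selmer-shape witness at `W₀`», `rung_39675m1_of_facts_of_inputs`) ·
`stub_etaLower_r0_lowerBSD` (L₀ on the r0 tower-onto partners; `etaLower_r0_of_stubs` composes it with the LANDED converse).

Sources: Kobayashi2003 (§4 Even MC, Thm 4.1, Thm 7.4), Kato2004Asterisque (Conj. 12.10, Thm 12.5),
FouquetWan2021 (arXiv:2107.13726, PRE), Kim2026 (AJM 148 Thm 1.8 (6)), PollackRubin2004.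
-/

-- v6: the directory name repeats the summit name (sibling precedent `Theorems/…PlusEtaLowerInclusionCastellaSanoRoad.lean`)
set_option linter.dupNamespace false

noncomputable section

open scoped Classical

open CongruenceSubgroup Field WeierstrassCurve Literature.NumberTheory.EllipticCurves
open Literature.NumberTheory.EllipticCurves.ModularForms Literature.NumberTheory.GaloisRepresentations
open Literature.NumberTheory.GaloisCohomology
open Literature.NumberTheory.EllipticCurves.Rank1Residual
open Literature.NumberTheory.EllipticCurves.Rank1Residual.Typed
open Summit.BirchSwinnertonDyer.Rank1Residual Summit.BirchSwinnertonDyer.Rank1Residual.Additive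
open Summit.BirchSwinnertonDyer.BirchSwinnertonDyer.Theses.QuadraticBranchSignedControl
open Summit.BirchSwinnertonDyer.BirchSwinnertonDyer.Theorems

namespace Summit.BirchSwinnertonDyer.BirchSwinnertonDyer.Cruxes.PlusEtaLowerInclusion.Birth

/-- The Fouquet–Wan sub-locus of Gss2, read on the good twist `V` at `p` (verbatim the parent skeleton's). -/
abbrev FWLocus (V : WeierstrassCurve ℚ) [V.IsElliptic] (p : ℕ) [Fact p.Prime] : Prop :=
  ∃ (W : WeierstrassCurve ℚ) (_ : W.IsElliptic) (_ : W.IsGloballyMinimal) (C : VariableChange ℚ),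
    C • W.quadraticTwist ((-1) ^ (p / 2) * p) = V ∧ Addv W p ∧ SubGss W p ∧
      FWNonsplitRam W p ∧ Kato2004.ImageContainsSL2 W p

/-- The explicit Gss2 partner of the BC5 rung: `39675m1` (Cremona), minimal model `[0,−1,1,−506958,−159508807]`. -/
def W39675m1 : WeierstrassCurve ℚ := ⟨0, -1, 1, -506958, -159508807⟩

/-- Statement of `stub_etaLower_fwLocus`: (E⁺_η) on the tower-onto twists INSIDE the Fouquet–Wan sub-locus.
[cite: FouquetWan2021, Thm. 5.1 (PRE)] [cite: Kobayashi2003, Thm. 7.4 proof (p. 13)] -/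
abbrev Sig.stub_etaLower_fwLocus : Prop :=
  ∀ (V : WeierstrassCurve ℚ) [V.IsElliptic] [V.IsGloballyMinimal] (p : ℕ) [Fact p.Prime],
    5 ≤ p → V.HasGoodReductionAtPrime p → V.frobeniusTrace p = 0 →
    (∀ m : ℕ, V.HasSurjectiveModNGaloisRep (p ^ m : ℕ)) → FWLocus V p →
      QuadraticBranchPlusEtaLowerInclusionAt V p

/-- Statement of `stub_etaLower_offLocus`: (E⁺_η) on the tower-onto twists OUTSIDE the Fouquet–Wan
sub-locus — nothing in print. [cite: Kobayashi2003, §4 Even main conjecture (p. 8)] -/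
abbrev Sig.stub_etaLower_offLocus : Prop :=
  ∀ (V : WeierstrassCurve ℚ) [V.IsElliptic] [V.IsGloballyMinimal] (p : ℕ) [Fact p.Prime],
    5 ≤ p → V.HasGoodReductionAtPrime p → V.frobeniusTrace p = 0 →
    (∀ m : ℕ, V.HasSurjectiveModNGaloisRep (p ^ m : ℕ)) → ¬ FWLocus V p →
      QuadraticBranchPlusEtaLowerInclusionAt V p

/-- Statement of the BC5 PLAN-ONLY rung `stub_etaLower_rung_39675m1`: (E⁺_η) at `p = 5` for the good twist
`V` of `W₀ = 39675m1` by `5* = 5` (one explicit Gss2 pair; not consumed by `_of`).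
[cite: Kim2026, Thm. 1.8 (6)] [cite: Kobayashi2003, Thm. 1.2, Thm. 4.1] -/
abbrev Sig.stub_etaLower_rung_39675m1 : Prop :=
  ∀ (V : WeierstrassCurve ℚ) [V.IsElliptic] [V.IsGloballyMinimal] [Fact (5 : ℕ).Prime],
    (∃ C : VariableChange ℚ, C • W39675m1.quadraticTwist 5 = V) →
    V.HasGoodReductionAtPrime 5 → V.frobeniusTrace 5 = 0 →
    (∀ m : ℕ, V.HasSurjectiveModNGaloisRep (5 ^ m : ℕ)) →
      QuadraticBranchPlusEtaLowerInclusionAt V 5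

/-- Statement of `stub_etaLower_r0_lowerBSD` (v2): L₀ — `ord_p #Ш(W)_an ≤ ord_p #Ш(W)` (`MissingLowerBoundAt`) —
on the additive Gss2 partners `W` (`C • W^{(p*)} = V`) of the `p`-adic-tower-onto good supersingular twists `V`
(`a_p(V) = 0`, `p ≥ 5`) with `L(W,1) ≠ 0`. Class-wide = Kato's lower inclusion for `f_W` (open); per pair = one
unit Kurihara number (Kim 2026 Thm 1.8 (6)). [cite: Kato2004Asterisque, Conj. 12.10] [cite: Kim2026, Thm. 1.8 (6)] -/
abbrev Sig.stub_etaLower_r0_lowerBSD : Prop :=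
  ∀ (V : WeierstrassCurve ℚ) [V.IsElliptic] [V.IsGloballyMinimal] (W : WeierstrassCurve ℚ) [W.IsElliptic]
    [W.IsGloballyMinimal] (C : VariableChange ℚ) (p : ℕ) [Fact p.Prime],
    5 ≤ p → C • W.quadraticTwist ((-1) ^ (p / 2) * p) = V →
    V.HasGoodReductionAtPrime p → V.frobeniusTrace p = 0 →
    (∀ m : ℕ, V.HasSurjectiveModNGaloisRep (p ^ m : ℕ)) → W.entireLFunction 1 ≠ 0 →
      MissingLowerBoundAt W p

theorem stub_etaLower_fwLocus : Sig.stub_etaLower_fwLocus := by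
  sorry

theorem stub_etaLower_offLocus : Sig.stub_etaLower_offLocus := by
  sorry

theorem stub_etaLower_rung_39675m1 : Sig.stub_etaLower_rung_39675m1 := by
  sorry

theorem stub_etaLower_r0_lowerBSD : Sig.stub_etaLower_r0_lowerBSD := by
  sorry

/-- The BC5 rung from its INPUTS form (LANDED, p465828) — what the registered rung stub still owes: the four named facts
(Kobayashi 2.2_η / 4.1_η, Kitajima–Otsuki 1.3, modularity) and the two displayed row data of `W₀ = 39675m1` at `5`
(`L(W₀,1) ≠ 0`; the Selmer-shape lower witness `v₅(L(W₀,1)/Ω) ≤ ord₅ #Sel_{5^∞}(W₀)`). No sorry. -/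
theorem rung_39675m1_of_facts_of_inputs
    (h22 : Kobayashi2003.thm22_etaSignedSelmerDual_finite_torsion)
    (h41 : Kobayashi2003.thm41_plusEtaCharIdeal_dvd)
    (hKO : KitajimaOtsuki2018.mainThm13_etaSignedSelmerDual_noFiniteSubmodule)
    (hmod : hasEntireLFunction_rat) (hLW : W39675m1.entireLFunction 1 ≠ 0)
    (hwit : ∃ q : ℚ, W39675m1.entireLFunction 1 / (W39675m1.realPeriodRat : ℂ) = (q : ℂ) ∧
      padicValRat 5 q ≤ (padicValNat 5 (Nat.card ↥(W39675m1.selmerGroupPInfty 5)) : ℤ)) :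
    Sig.stub_etaLower_rung_39675m1 := by
  intro V _ _ _ hC hg ha hs
  exact PlusEtaLowerInclusionRung39675m1.stub_etaLower_rung_39675m1_inputs h22 h41 hKO hmod hLW hwit V hC hg ha hs

/-- The r0 sub-cut composed (v4): on a tower-onto pair with `L(W,1) ≠ 0`, (E⁺_η)(V) from the L₀ stub, the LANDED converse
control (p468146 `PlusEtaLowerInclusionR0OfLowerBSD.stub_etaLower_r0_ofLowerBSD`, ctrl g4) and the named facts — records that
`stub_etaLower_r0_lowerBSD` ALONE now covers the r0 rows of BOTH locus stubs modulo Poitou–Tate, Kobayashi 2.2_η / 4.1_η,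
Kitajima–Otsuki 1.3, modularity, GZK. -/
theorem etaLower_r0_of_stubs (hlow : Sig.stub_etaLower_r0_lowerBSD)
    (hPT : poitouTate_selmerStructure_duality_real ℚ)
    (h22 : Kobayashi2003.thm22_etaSignedSelmerDual_finite_torsion)
    (h41 : Kobayashi2003.thm41_plusEtaCharIdeal_dvd)
    (hKO : KitajimaOtsuki2018.mainThm13_etaSignedSelmerDual_noFiniteSubmodule)
    (hmod : hasEntireLFunction_rat) (hGZK : rank_eq_analyticRank_of_analyticRank_le_one)
    (V : WeierstrassCurve ℚ) [V.IsElliptic] [V.IsGloballyMinimal] (W : WeierstrassCurve ℚ) [W.IsElliptic]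
    [W.IsGloballyMinimal] (C : VariableChange ℚ) (p : ℕ) [Fact p.Prime] (h5 : 5 ≤ p)
    (hCV : C • W.quadraticTwist ((-1) ^ (p / 2) * p) = V) (hg : V.HasGoodReductionAtPrime p)
    (ha : V.frobeniusTrace p = 0) (hs : ∀ m : ℕ, V.HasSurjectiveModNGaloisRep (p ^ m : ℕ))
    (hL : W.entireLFunction 1 ≠ 0) : QuadraticBranchPlusEtaLowerInclusionAt V p :=
  PlusEtaLowerInclusionR0OfLowerBSD.stub_etaLower_r0_ofLowerBSD hPT h22 h41 hKO hmod hGZK V W C p h5 hCV hg ha hs hL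
    (hlow V W C p h5 hCV hg ha hs hL)

/-- The locus split gives the child crux BY NAME (v4's composition; SECONDARY since v6 — the primary `_of` is the
Castella–Sano cut in input currency below). -/
theorem PlusEtaLowerInclusion_of_locusCut (hfw : Sig.stub_etaLower_fwLocus) (hoff : Sig.stub_etaLower_offLocus) :
    PlusEtaLowerInclusion := by
  intro V _ _ p _ h5 hg ha hs
  by_cases hL : FWLocus V p
  · exact hfw V p h5 hg ha hs hL
  · exact hoff V p h5 hg ha hs hL

/-- The child crux from the (sorried) locus stubs — records that the locus stub set is complete. -/
theorem plusEtaLowerInclusion_of_locusStubs : PlusEtaLowerInclusion :=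
  PlusEtaLowerInclusion_of_locusCut stub_etaLower_fwLocus stub_etaLower_offLocus


/-! ## v6 — THE CASTELLA–SANO CUT IN INPUT CURRENCY (seat k8eta-c1 g14 on planner g28's R269; over p632747
`PlusEtaCastellaSanoRoad` (B); replaces v5's Kurihara cut, whose two statements are DERIVED below) -/

/-- Statement of `stub_etaLower_kuriharaUnit_tamFreeRows` (CONTENT stub; = `hKur` of
`PlusEtaCastellaSanoRoad.plusEtaLowerInclusion_of_kim111_of_cs26_of_maninFacts_of_kuriharaUnit_of_kimDefect` VERBATIM): for
every tower-onto good supersingular `a_p = 0` twist `V` (`p ≥ 5`), every globally minimal partner `W` (`C • W^{(p*)} = V`) with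
`p ∤ ∏ c_ℓ(W)`, and every ADMISSIBLE modular parametrisation datum `D` of `W` (`p ∤ c_D`, `p`-unit period transfer
`Ω(W) = u·Ω⁺_{D.f}`), a unit mod-`p` Kurihara number of `D.f` at a cyclic `𝒩₁`-level: `X4.KuriharaUnitAt W p D.f` — KURIHARA'S
CONJECTURE mod `p` for the additive partner (Kim Conj. 1.9 = Castella–Sano Conj. 1; open per row in general; by Kim Thm. 1.10
equivalent at the row to Kato's IMC for `f_W`). EVIDENCE: 3098/3098 Tamagawa-free partners at `p ∈ {5, 7}` carry one (seat
k8eta-c1 g7/g8 censuses); why_might_fail: a Tamagawa-free partner all of whose cyclic-level Kurihara numbers vanish mod `p`.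
[cite: Kim2022StructureSelmer, Conj. 1.9 and Thm. 1.10 (PDF p. 8), Remark 6.2 (PDF p. 31)] [cite: CastellaSano2026, Conj. 1 (PDF p. 3)]
[cite: Kurihara2014, §1] -/
abbrev Sig.stub_etaLower_kuriharaUnit_tamFreeRows : Prop :=
  ∀ (V : WeierstrassCurve ℚ) [V.IsElliptic] [V.IsGloballyMinimal] (W : WeierstrassCurve ℚ)
    [W.IsElliptic] [W.IsGloballyMinimal] (C : VariableChange ℚ) (p : ℕ) [Fact p.Prime],
    5 ≤ p → C • W.quadraticTwist ((-1) ^ (p / 2) * p) = V → V.HasGoodReductionAtPrime p →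
    V.frobeniusTrace p = 0 → (∀ m : ℕ, V.HasSurjectiveModNGaloisRep (p ^ m : ℕ)) →
    ¬ p ∣ W.tamagawaProduct →
    ∀ {NW : ℕ} [NeZero NW] (D : ModularParametrizationData W NW),
      ¬ (p : ℤ) ∣ D.maninConstant →
      (∃ u : ℚ, ‖(u : ℚ_[p])‖ = 1 ∧ W.realPeriodRat = u * plusPeriod D.f) →
      X4.KuriharaUnitAt W p D.f

/-- Statement of `stub_etaLower_kimDefect_tamRows` (CONTENT stub, the hardest; = `hDef` of
`PlusEtaCastellaSanoRoad.plusEtaLowerInclusion_of_kim111_of_cs26_of_maninFacts_of_kuriharaUnit_of_kimDefect` VERBATIM): for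
every tower-onto good supersingular `a_p = 0` twist `V` (`p ≥ 5`), every globally minimal partner `W` with `p ∣ ∏ c_ℓ(W)`, and
every admissible datum `D` of `W`, KIM'S TAMAGAWA-DEFECT IDENTITY `X4.KimTamagawaDefectAt W p D.f`:
`∂^{(∞)}(δ̃(D.f)) = ord_p ∏_v c_v(W)` — Kim's Conjecture 1.10 = Castella–Sano's Conjecture 2 («refined Kurihara») on the
Tamagawa partners of the crux. OPEN per row and class-wide (no proof in print at an additive `p`). Per row its `≤` half is a
FINITE CERTIFICATE (one cyclic Kolyvagin level `n ∈ 𝒩_k`, `k ≤ t + 1`, with `δ̃_n ≢ 0 (mod p^k)` of index `≤ t := ord_p ∏ c_v`;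
`X4.exists_certificate_of_kuriharaPartialInfty_le`) — CERTIFIED on 20/20 Tamagawa census rows (k8eta-c1 g13 kit j308348: 15/15 r1
rows, one level-(t+1) prime with `v_p(δ_ℓ) = t` each; r0 rows g5/g6); its `≥` half («every cyclic-level Kurihara number is
divisible by `p^t`») is the Kato-integrality side — 0 violations in 275 computed levels, NOT finitely certifiable.
why_might_fail: a Tamagawa partner with a cyclic-level Kurihara number of `p`-index `< ord_p ∏ c_v` (refutes the `≥` half at the
row) or with all Kurihara numbers divisible by `p^{t+1}` (refutes the `≤` half).
[cite: Kim2022StructureSelmer, Conj. 1.10 (PDF p. 8), Remark 6.2 (PDF p. 31)] [cite: CastellaSano2026, Conj. 2 and Thm. 1 (PDF p. 4), §1.3.1 (PDF p. 6)] -/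
abbrev Sig.stub_etaLower_kimDefect_tamRows : Prop :=
  ∀ (V : WeierstrassCurve ℚ) [V.IsElliptic] [V.IsGloballyMinimal] (W : WeierstrassCurve ℚ)
    [W.IsElliptic] [W.IsGloballyMinimal] (C : VariableChange ℚ) (p : ℕ) [Fact p.Prime],
    5 ≤ p → C • W.quadraticTwist ((-1) ^ (p / 2) * p) = V → V.HasGoodReductionAtPrime p →
    V.frobeniusTrace p = 0 → (∀ m : ℕ, V.HasSurjectiveModNGaloisRep (p ^ m : ℕ)) →
    p ∣ W.tamagawaProduct →
    ∀ {NW : ℕ} [NeZero NW] (D : ModularParametrizationData W NW),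
      ¬ (p : ℤ) ∣ D.maninConstant →
      (∃ u : ℚ, ‖(u : ℚ_[p])‖ = 1 ∧ W.realPeriodRat = u * plusPeriod D.f) →
      X4.KimTamagawaDefectAt W p D.f

/-- Statement of the HELD INPUT stub `stub_input_kim111Eta` (cite-level, PUBLISHED): Kim 2026 (Amer. J. Math. 148) Thm. 1.11
(1) ⟹ (3) read at `η` on Kobayashi's `η`-package — a unit Kurihara number of the additive partner gives Kato's IMC for `f_W`,
hence the Eisenstein inclusion at `η` (the Literature `def : Prop`, flag `Kim26-111-eta-zeta-line`; p534181). Not a prover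
target: closes only by `theorem …_holds` in Literature. [cite: Kim2022StructureSelmer, Thm. 1.11 (PDF p. 8)] -/
abbrev Sig.stub_input_kim111Eta : Prop :=
  Kim2026.thm111_etaEisensteinInclusion_of_kuriharaNumber_ne_zero

/-- Statement of the HELD INPUT stub `stub_input_cs26Eta` (cite-level, PREPRINT — NOT A FACT): Castella–Sano, *On refined
nonvanishing conjectures by Kurihara and Kolyvagin*, arXiv:2601.14504 (January 2026, UNREFEREED), Thm. 1 (i) ⟹ (ii) read at `η`
for `E := W` (non-CM, `p > 3`, `ρ̄` onto, Manin constant prime to `p`, ANY reduction type): Kim's identity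
`𝓜_∞(δ) = ord_p Tam_W` gives Kato's IMC over `ℚ_∞`, hence the Eisenstein inclusion at `η` — the Literature OPEN binder
(`[claim/under-review]`, no `_holds`; p631508, review-accepted as faithful). W2 watch: its DOI / referee acceptance, or
Kurihara–Sakamoto («forthcoming», §1.3.1) ⇒ re-type as a `[cite]` fact. Not a prover target.
[cite: CastellaSano2026, Thm. 1 (PDF p. 4), §1.3.1 (PDF p. 6), §2.4 (PDF pp. 10–11)] -/
abbrev Sig.stub_input_cs26Eta : Prop :=
  CastellaSano2026.thm1_etaEisensteinInclusion_of_kimTamagawaDefect_OPEN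

/-- Statement of the HELD INPUT stub `stub_input_maninFacts` (cite-level, PUBLISHED): the four Manin-constant / modularity facts
that give every tower-onto partner an admissible parametrisation datum (`PlusEtaManinInput.maninInput_of_quadraticBranch`, g9):
Mazur 1978 Cor. 4.1 (odd `p`, `p² ∤ N'` ⇒ `p ∤ c` for the optimal datum), Abbes–Ullmo 1996 Thm. A (`p ∤ N' ⇒ p ∤ c`),
Česnavičius 2018 Thm. 1.2 (`2 ∥ N' ⇒ 2 ∤ c`), and modularity Version `L` (`exists_isNewformOf`). Not a prover target.
[cite: Mazur1978, Cor. 4.1] [cite: AbbesUllmo1996, Thm. A] [cite: Cesnavicius2018, Thm. 1.2] [cite: DiamondShurman2005, Thm. 8.8.3] -/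
abbrev Sig.stub_input_maninFacts : Prop :=
  mazur_not_dvd_maninConstant_of_odd ∧ abbesUllmo_not_dvd_maninConstant_of_not_dvd_level ∧
    cesnavicius_not_two_dvd_maninConstant_of_two_dvd_level ∧ exists_isNewformOf

theorem stub_etaLower_kuriharaUnit_tamFreeRows : Sig.stub_etaLower_kuriharaUnit_tamFreeRows := by
  sorry

theorem stub_etaLower_kimDefect_tamRows : Sig.stub_etaLower_kimDefect_tamRows := by
  sorry

/-- Statement of the ONE HELD INPUT stub of v6b, `stub_input_etaNamedFacts` (cite-level; the three displayed inputs of the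
Castella–Sano cut bundled so that the registered stub count is 7 = stubs_max): Kim 1.11_η (PUBLISHED) ∧ Castella–Sano Thm. 1_η
(PREPRINT arXiv:2601.14504 — NOT a fact) ∧ the four Manin/modularity facts (PUBLISHED). Not a prover target.
[cite: Kim2022StructureSelmer, Thm. 1.11 (PDF p. 8)] [cite: CastellaSano2026, Thm. 1 (PDF p. 4)] [cite: Mazur1978, Cor. 4.1]
[cite: Cesnavicius2018, Thm. 1.2] -/
abbrev Sig.stub_input_etaNamedFacts : Prop :=
  Sig.stub_input_kim111Eta ∧ Sig.stub_input_cs26Eta ∧ Sig.stub_input_maninFacts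

theorem stub_input_etaNamedFacts : Sig.stub_input_etaNamedFacts := by
  sorry

/-- **Composition (v6, PRIMARY): the child crux BY NAME from the five stubs of the Castella–Sano cut** — argument bundling over
seat g13's landed (B) theorem `PlusEtaCastellaSanoRoad.plusEtaLowerInclusion_of_kim111_of_cs26_of_maninFacts_of_kuriharaUnit_of_kimDefect`
(p632747): Tamagawa-free partners — the unit Kurihara number of an admissible datum (Manin facts) fires Kim 1.11_η through g8's
Kurihara cut; Tamagawa partners — Kim's identity fires Castella–Sano Thm. 1_η. CONDITIONAL on three cite-level inputs (one a
PREPRINT claim) and two OPEN per-row conjecture statements; closes nothing by itself; nothing booked.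
[cite: Kim2022StructureSelmer, Thm. 1.11, Conj. 1.9, Conj. 1.10 (PDF p. 8)] [cite: CastellaSano2026, Thm. 1, Conj. 1, Conj. 2 (PDF pp. 3–4)]
[cite: Kobayashi2003, §4 Even main conjecture (p. 8), proof of Thm. 7.4 (p. 13)] -/
theorem PlusEtaLowerInclusion_of (hKim : Sig.stub_input_kim111Eta) (hCS : Sig.stub_input_cs26Eta)
    (hMF : Sig.stub_input_maninFacts) (hKur : Sig.stub_etaLower_kuriharaUnit_tamFreeRows)
    (hDef : Sig.stub_etaLower_kimDefect_tamRows) : PlusEtaLowerInclusion :=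
  PlusEtaCastellaSanoRoad.plusEtaLowerInclusion_of_kim111_of_cs26_of_maninFacts_of_kuriharaUnit_of_kimDefect
    hKim hCS hMF.1 hMF.2.1 hMF.2.2.1 hMF.2.2.2 hKur hDef

/-- The child crux from the (sorried) stubs of the Castella–Sano cut — records that the v6 stub set is complete. -/
theorem plusEtaLowerInclusion_of_stubs : PlusEtaLowerInclusion :=
  PlusEtaLowerInclusion_of stub_input_etaNamedFacts.1 stub_input_etaNamedFacts.2.1 stub_input_etaNamedFacts.2.2
    stub_etaLower_kuriharaUnit_tamFreeRows stub_etaLower_kimDefect_tamRows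


/-! ## v5's Kurihara cut — its two statements DERIVED from the v6 stubs (no longer registered; kept so that everything keyed
by the v5 currency stays connected: p599308 `PlusEtaKuriharaCut`, the (E⁺_η)-currency Tamagawa statement, the records) -/

/-- Statement of v5's `stub_etaLower_kurihara_tamFree` (Σ₁ currency, NOT registered since v6): every Tamagawa-`p`-free globally
minimal partner `W` (`C • W^{(p*)} = V`) of a tower-onto good supersingular `a_p = 0` twist `V`, `p ≥ 5`, carries SOME modular
parametrisation datum `D` with `p ∤ c_D` and a `p`-unit period transfer, and SOME cyclic `𝒩₁`-level `n` with surjective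
characters `ψ` and a unit Kurihara number `δ̃_n(D.f, ψ) ≠ 0` — Manin's input + Kurihara's conjecture mod `p`, verbatim the data
binders of the road `PlusEtaKuriharaT0.etaPair_of_thm111_of_kuriharaUnit`. Follows from `stub_input_maninFacts` +
`stub_etaLower_kuriharaUnit_tamFreeRows` (`kurihara_tamFree_of_maninFacts_of_kuriharaUnit`).
[cite: Kim2022StructureSelmer, Conj. 1.9, §1.3.5, Remark 6.2] [cite: CesnaviciusNeururerSaha2023, §1 (Cremona's Manin data)] -/
abbrev Sig.stub_etaLower_kurihara_tamFree : Prop :=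
  ∀ (V : WeierstrassCurve ℚ) [V.IsElliptic] [V.IsGloballyMinimal] (W : WeierstrassCurve ℚ)
    [W.IsElliptic] [W.IsGloballyMinimal] (C : VariableChange ℚ) (p : ℕ) [Fact p.Prime],
    5 ≤ p → C • W.quadraticTwist ((-1) ^ (p / 2) * p) = V → V.HasGoodReductionAtPrime p →
    V.frobeniusTrace p = 0 → (∀ m : ℕ, V.HasSurjectiveModNGaloisRep (p ^ m : ℕ)) →
    ¬ p ∣ W.tamagawaProduct →
    ∃ (NW : ℕ) (_ : NeZero NW) (D : ModularParametrizationData W NW),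
      ¬ (p : ℤ) ∣ D.maninConstant ∧
      (∃ u : ℚ, ‖(u : ℚ_[p])‖ = 1 ∧ W.realPeriodRat = u * plusPeriod D.f) ∧
      ∃ (n : ℕ) (_ : NeZero n), Kato.IsKolyvaginProduct W p 1 n ∧
        (∀ (ℓ : ℕ) [Fact ℓ.Prime], ℓ ∣ n →
          Nat.card {P : ((WeierstrassCurve.integralModelInt W).map
            (Int.castRingHom (ZMod ℓ))).toAffine.Point // p • P = 0} ≤ p) ∧
        ∃ ψ : (ℓ : ℕ) → (ZMod ℓ)ˣ →* Multiplicative (ZMod p),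
          (∀ ℓ ∈ n.primeFactors, Function.Surjective (ψ ℓ)) ∧ kuriharaNumber D.f p n ψ ≠ 0

/-- Statement of v5's `stub_etaLower_tamagawaRows` ((E⁺_η)-currency, NOT registered since v6): (E⁺_η) on the tower-onto pairs
whose globally minimal partner `W` has `p ∣ ∏ c_ℓ(W)` — Kato's lower inclusion for `f_W` on the Tamagawa rows. Follows from
`stub_input_cs26Eta` + `stub_input_maninFacts` + `stub_etaLower_kimDefect_tamRows` (`tamagawaRows_of_cs26_of_maninFacts_of_kimDefect`
= g13's `PlusEtaCastellaSanoRoad.tamagawaRows_of_cs26_of_maninFacts_of_kimConj110`). [cite: Kim2022StructureSelmer, Thm. 1.4, Remark 6.2]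
[cite: Kato2004Asterisque, Conj. 12.10] [cite: Kobayashi2003, §4 Even main conjecture (p. 8)] -/
abbrev Sig.stub_etaLower_tamagawaRows : Prop :=
  ∀ (V : WeierstrassCurve ℚ) [V.IsElliptic] [V.IsGloballyMinimal] (W : WeierstrassCurve ℚ)
    [W.IsElliptic] [W.IsGloballyMinimal] (C : VariableChange ℚ) (p : ℕ) [Fact p.Prime],
    5 ≤ p → C • W.quadraticTwist ((-1) ^ (p / 2) * p) = V → V.HasGoodReductionAtPrime p →
    V.frobeniusTrace p = 0 → (∀ m : ℕ, V.HasSurjectiveModNGaloisRep (p ^ m : ℕ)) →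
    p ∣ W.tamagawaProduct → QuadraticBranchPlusEtaLowerInclusionAt V p

/-- **v5's Σ₁ stub from the v6 stubs** (no sorry of its own): the Manin datum from the four published facts
(`PlusEtaManinInput.maninInput_of_quadraticBranch`, g9 p608713), `ρ̄_{W,p}` onto from the tower, the unit Kurihara number from
`stub_etaLower_kuriharaUnit_tamFreeRows` at that datum, moduli transported along `p ^ 1 = p`
(`PlusEtaCastellaSanoRoad.exists_kuriharaUnit_of_kuriharaUnitAt`). [cite: Kim2022StructureSelmer, Conj. 1.9 (PDF p. 8)]
[cite: Mazur1978, Cor. 4.1] [cite: Cesnavicius2018, Thm. 1.2] -/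
theorem kurihara_tamFree_of_maninFacts_of_kuriharaUnit (hMF : Sig.stub_input_maninFacts)
    (hKur : Sig.stub_etaLower_kuriharaUnit_tamFreeRows) : Sig.stub_etaLower_kurihara_tamFree := by
  intro V _ _ W _ _ C p _ h5 hCV hgood hap htower htam
  have hsurj : W.HasSurjectiveModNGaloisRep p :=
    PlusEtaCastellaSanoRoad.hasSurjectiveModNGaloisRep_partner_of_tower C p hCV htower
  obtain ⟨NW, _, D, hc, hper⟩ :=
    PlusEtaManinInput.maninInput_of_quadraticBranch hMF.1 hMF.2.1 hMF.2.2.1 hMF.2.2.2 C p (by omega) hCV hgood hsurj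
  obtain ⟨n, _, hn, hcyc, ψ, hψ, hδ⟩ := PlusEtaCastellaSanoRoad.exists_kuriharaUnit_of_kuriharaUnitAt W p D.f
    (hKur V W C p h5 hCV hgood hap htower htam D hc hper)
  exact ⟨NW, inferInstance, D, hc, hper, n, inferInstance, hn, hcyc, ψ, hψ, hδ⟩

/-- **v5's Tamagawa stub from the v6 stubs** (no sorry of its own) — g13's §3 reduction
`PlusEtaCastellaSanoRoad.tamagawaRows_of_cs26_of_maninFacts_of_kimConj110` with the Manin conjunction unbundled.
[cite: CastellaSano2026, Thm. 1 and Conj. 2 (PDF p. 4)] [cite: Kim2022StructureSelmer, Conj. 1.10 (PDF p. 8)] -/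
theorem tamagawaRows_of_cs26_of_maninFacts_of_kimDefect (hCS : Sig.stub_input_cs26Eta)
    (hMF : Sig.stub_input_maninFacts) (hDef : Sig.stub_etaLower_kimDefect_tamRows) : Sig.stub_etaLower_tamagawaRows :=
  PlusEtaCastellaSanoRoad.tamagawaRows_of_cs26_of_maninFacts_of_kimConj110 hCS hMF.1 hMF.2.1 hMF.2.2.1 hMF.2.2.2 hDef

/-- Composition (v5, the Kurihara cut, kept): the child crux BY NAME from the Σ₁ Kurihara datum on the Tamagawa-free partners + the
Tamagawa rows, MODULO Kim 2026 Thm. 1.11 (1) ⟹ (3) at `η` — one line over p599308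
`PlusEtaKuriharaCut.plusEtaLowerInclusion_of_kim111_of_kuriharaData_of_tamagawaRows`.
[cite: Kim2022StructureSelmer, Thm. 1.11 (PDF p. 8), Conj. 1.9, Remark 6.2] -/
theorem PlusEtaLowerInclusion_of_kuriharaCut (hKim : Sig.stub_input_kim111Eta)
    (hKur : Sig.stub_etaLower_kurihara_tamFree) (hTam : Sig.stub_etaLower_tamagawaRows) :
    PlusEtaLowerInclusion :=
  PlusEtaKuriharaCut.plusEtaLowerInclusion_of_kim111_of_kuriharaData_of_tamagawaRows hKim hKur hTam

/-- The two cuts agree: v5's Kurihara-cut composition fed with the v6 stubs (through the two derivations above) — a second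
proof term of the crux by name from the same five stubs. -/
theorem plusEtaLowerInclusion_of_stubs_viaKuriharaCut : PlusEtaLowerInclusion :=
  PlusEtaLowerInclusion_of_kuriharaCut stub_input_etaNamedFacts.1
    (kurihara_tamFree_of_maninFacts_of_kuriharaUnit stub_input_etaNamedFacts.2.2
      stub_etaLower_kuriharaUnit_tamFreeRows)
    (tamagawaRows_of_cs26_of_maninFacts_of_kimDefect stub_input_etaNamedFacts.2.1 stub_input_etaNamedFacts.2.2
      stub_etaLower_kimDefect_tamRows)

/-- **The whole printed conjecture suffices for both content stubs** (Kim's Conjecture 1.10, the typed tree sentence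
`X4.kim2026_conjecture_1_10`, restricted to nothing): on a Tamagawa-free partner the identity reads `∂^{(∞)} = 0`, a unit
Kurihara number (`X4.kimTamagawaDefectLeAt_iff_kuriharaUnitAt_of_not_dvd`). Records that the two content stubs are the
row-restrictions of ONE print-named conjecture. [cite: Kim2022StructureSelmer, Conj. 1.10 (PDF p. 8)] -/
theorem contentStubs_of_kim2026Conjecture110 (hK110 : X4.kim2026_conjecture_1_10) :
    Sig.stub_etaLower_kuriharaUnit_tamFreeRows ∧ Sig.stub_etaLower_kimDefect_tamRows := by
  refine ⟨?_, ?_⟩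
  · intro V _ _ W _ _ C p _ h5 hCV _hgood _hap htower htam NW _ D hc hper
    have hKD : X4.KimTamagawaDefectAt W p D.f :=
      hK110 W p h5 (PlusEtaCastellaSanoRoad.hasSurjectiveModNGaloisRep_partner_of_tower C p hCV htower) D hc hper
    exact (X4.kimTamagawaDefectLeAt_iff_kuriharaUnitAt_of_not_dvd W p D.f htam).mp
      ((X4.kimTamagawaDefectAt_iff W p D.f).mp hKD).1
  · intro V _ _ W _ _ C p _ h5 hCV _hgood _hap htower _htam NW _ D hc hper
    exact hK110 W p h5 (PlusEtaCastellaSanoRoad.hasSurjectiveModNGaloisRep_partner_of_tower C p hCV htower) D hc hper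

end Summit.BirchSwinnertonDyer.BirchSwinnertonDyer.Cruxes.PlusEtaLowerInclusion.Birth

end
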